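import Summits.NavierStokesRegularity.FunctionalMining.TopBotEigSplitSharePlanar
import Mathlib.Analysis.Convex.SpecificFunctions.Basic
import Mathlib.Analysis.Convex.SpecificFunctions.Pow
import HarnessLib

/-!
# FunctionalMining — the closed form of the convexity defect `T = q·N·N″ − (q − 1)·N′²` on the test line for
# every real `q`, and (W) `T ≥ 0` AT THE PLANAR SHARE `c_pl(q)` for every `1 < q ≤ 7/4`

HONEST FRAMING. Search for candidate a priori estimates; no regularity claim. One-variable real analysis (real
powers) on the line functions of K16 part 1 (`NoGo/TopBotEigSplitShareWallLine`: `lineNsq u = 6u² − 6u + 2 =: s`,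
`lineN`, `lineN1`, `lineN2`, `lineT`); nothing about Navier–Stokes. Cell `pub-nsfunc`, prove seat (gen 27);
sequel of `TopBotEigSplitSharePlanar` (the planar share `cPlanar q = ((q − 1)/3)·2^{1 − q/2}`, its necessity for
every real `q > 1`, and (N⁺), (D) at `c_pl(q)` for `1 < q ≤ 2`).

WHAT IS PROVED HERE [ours]:
* §P4 **`lineT_closed_form`** (every real `q`, `c`, `u ∈ (0, 1)`):
  `T = q²·[(q − 1)(u(1 − u))^{q−2} + 3c²s^{q−2} − 3c(2 − q)(u^q + (1 − u)^q)s^{q/2−2} − 2c(q − 1)(u^{q−2} + (1 − u)^{q−2})s^{q/2−1}]`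
  — the `c`-free part from `(u^q + v^q)(u^{q−2} + v^{q−2}) − (u^{q−1} − v^{q−1})² = (uv)^{q−2}(u + v)²`, the `c²`
  part the monomial `3q²s^{q−2}` (census-1 (cc.219) `lineT_quadratic`, here re-derived), the `c`-linear part in
  closed form via `(12u − 6)² = 24s − 12` and `s + 6u(1 − u) = 2` (one `ring` after splitting off the atoms
  `u^{q−2}`, `(1 − u)^{q−2}`, `s^{q/2−2}`); `lineT_zero_share : T|_{c=0} = q²(q − 1)(u(1 − u))^{q−2}`.
* §P5 three elementary inequalities on `(0, 1)`, all TIGHT at `u = 1/2`: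
  W1 `sum_rpow_sub_two_le` (`1 ≤ q ≤ 2`): `u^{q−2} + (1 − u)^{q−2} ≤ 2·2^{q−2}(u(1 − u))^{q−2}` (concavity of
  `x^{2−q}`, Mathlib `Real.concaveOn_rpow`); W2 `sum_rpow_le_lineNsq` (`1 ≤ q ≤ 2`):
  `u^q + (1 − u)^q ≤ 2^{1−q/2}s^{q/2}` (power means `M_q ≤ M_2` by `convexOn_rpow` at the exponent `2/q`, and
  `(u² + (1 − u)²)/2 ≤ s/2`); W3 `two_rpow_mul_lineNsq_rpow_le` (`q ≤ 2`): `2^{2−q}s^{q−2} ≤ (u(1 − u))^{q−2}`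
  (`u(1 − u) ≤ s/2`, antitone power). Hence **`lineT_cPlanar_nonneg (hq : 1 < q) (hq2 : q ≤ 7/4) : 0 ≤ lineT q
  (cPlanar q) u`** for `u ∈ (0, 1)`: in the closed form, W1 (+ `s^{q/2−1} ≤ 2^{1−q/2}`) bounds the last term by
  `(4(q − 1)²/3)(u(1 − u))^{q−2}`, W2 the third by `(q − 1)(2 − q)2^{2−q}s^{q−2}`, so
  `T/q² ≥ ((q − 1)(7 − 4q)/3)·[(u(1 − u))^{q−2} − 2^{2−q}s^{q−2}] ≥ 0` by W3 — non-negative exactly when `q ≤ 7/4`.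
  With (N⁺) `lineN_cPlanar_pos` and (D) `lineD_cPlanar` this discharges ALL THREE hypotheses of K19's criterion
  at `c = c_pl(q)`, `1 < q ≤ 7/4`; the sector version for every `1 < q ≤ 2` and the composition with K19/K20a (the WINDOW `Iic (c_pl q)`) are the sequels
  `TopBotEigSplitSharePlanarSector` / `TopBotEigSplitSharePlanarWindow`.

SEQUEL. (W) at `c_pl(q)` on the SECTOR `(1/3, 2/3)` for every `1 < q ≤ 2` — keeping the exact `2^{2−q}s^{q−2}` term and
comparing slopes of one function of `x = 2s` — is `TopBotEigSplitSharePlanarSector.lineT_cPlanar_nonneg_sector`; the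
window `Iic (c_pl q)` for every `1 < q ≤ 2` is `TopBotEigSplitSharePlanarWindow`. NOT CLAIMED here: anything about
`heatDissipation`, `𝒦₀`, Navier–Stokes. Tree results used: K16 part 1 (`lineNsq`, `lineNsq_pos`, `lineN`, `lineN1`,
`lineN2`, `lineT`), `TopBotEigSplitSharePlanar` (`cPlanar`, `cPlanar_pos`, `half_rpow_half_sub_one`); Mathlib
`Real.concaveOn_rpow`, `convexOn_rpow`, `Real.rpow_le_rpow_of_nonpos`, `Real.rpow_add_one`, `Real.rpow_add_natCast`,
`Real.rpow_mul_natCast`, `Real.mul_rpow`, `Real.div_rpow`.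
[ours] = this programme's own elementary work. search for candidate a priori estimates; no regularity claim.
-/

open Set Filter Topology

noncomputable section

namespace Summit.NavierStokesRegularity.FunctionalMining

namespace TopEig

/-! ## P4. The closed form of `T` for every real `q` and `c`:
`T = q²·[(q − 1)(u(1 − u))^{q−2} + 3c²s^{q−2} − 3c(2 − q)(u^q + (1 − u)^q)s^{q/2−2} − 2c(q − 1)(u^{q−2} + (1 − u)^{q−2})s^{q/2−1}]` -/

/-- **Closed form of `T = q·N·N″ − (q − 1)·N′²` on `(0, 1)`, every real `q`, `c`.** The `c`-free part is
`q²(q − 1)(u(1 − u))^{q−2}` (from `(u^q + v^q)(u^{q−2} + v^{q−2}) − (u^{q−1} − v^{q−1})² = (uv)^{q−2}(u + v)²`,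
`v = 1 − u`), the `c²` part is the monomial `3q²s^{q−2}` (census-1 (cc.219)), and the `c`-linear part is
`−q²[3(2 − q)(u^q + v^q)s^{q/2−2} + 2(q − 1)(u^{q−2} + v^{q−2})s^{q/2−1}]` (using `(12u − 6)² = 24s − 12` and
`s + 6u(1 − u) = 2`). [ours] -/
theorem lineT_closed_form (q c : ℝ) {u : ℝ} (hu0 : 0 < u) (hu1 : u < 1) :
    lineT q c u = q ^ 2 * ((q - 1) * (u * (1 - u)) ^ (q - 2) + 3 * c ^ 2 * lineNsq u ^ (q - 2)
      - 3 * c * (2 - q) * (u ^ q + (1 - u) ^ q) * lineNsq u ^ (q / 2 - 2)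
      - 2 * c * (q - 1) * (u ^ (q - 2) + (1 - u) ^ (q - 2)) * lineNsq u ^ (q / 2 - 1)) := by
  have hv0 : 0 < 1 - u := by linarith
  have hs0 := lineNsq_pos u
  have e1 : u ^ (q - 1) = u ^ (q - 2) * u := by
    rw [← Real.rpow_add_one hu0.ne']; congr 1; ring
  have e2 : u ^ q = u ^ (q - 2) * u ^ 2 := by
    rw [← Real.rpow_add_natCast hu0.ne']; congr 1; push_cast; ring
  have e3 : (1 - u) ^ (q - 1) = (1 - u) ^ (q - 2) * (1 - u) := by
    rw [← Real.rpow_add_one hv0.ne']; congr 1; ring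
  have e4 : (1 - u) ^ q = (1 - u) ^ (q - 2) * (1 - u) ^ 2 := by
    rw [← Real.rpow_add_natCast hv0.ne']; congr 1; push_cast; ring
  have e5 : lineNsq u ^ (q / 2 - 1) = lineNsq u ^ (q / 2 - 2) * lineNsq u := by
    rw [← Real.rpow_add_one hs0.ne']; congr 1; ring
  have e6 : lineNsq u ^ (q / 2) = lineNsq u ^ (q / 2 - 2) * lineNsq u ^ 2 := by
    rw [← Real.rpow_add_natCast hs0.ne']; congr 1; push_cast; ring
  have e7 : lineNsq u ^ (q - 2) = (lineNsq u ^ (q / 2 - 2) * lineNsq u) ^ 2 := by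
    rw [← e5, ← Real.rpow_mul_natCast hs0.le]; congr 1; push_cast; ring
  have e8 : (u * (1 - u)) ^ (q - 2) = u ^ (q - 2) * (1 - u) ^ (q - 2) := Real.mul_rpow hu0.le hv0.le
  simp only [lineT, lineN, lineN1, lineN2]
  rw [e1, e2, e3, e4, e5, e6, e7, e8]
  unfold lineNsq
  ring

/-- `T` at `c = 0`: `q²(q − 1)(u(1 − u))^{q−2} ≥ 0` (the `ℓ^q` norm is convex). [bookkeeping] -/
theorem lineT_zero_share (q : ℝ) {u : ℝ} (hu0 : 0 < u) (hu1 : u < 1) :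
    lineT q 0 u = q ^ 2 * (q - 1) * (u * (1 - u)) ^ (q - 2) := by
  rw [lineT_closed_form q 0 hu0 hu1]; ring

/-! ## P5. (W) at the planar share for `1 < q ≤ 7/4`: `0 ≤ T` on `(0, 1)` — three elementary inequalities -/

/-- **W1.** `u^{q−2} + (1 − u)^{q−2} ≤ 2·2^{q−2}·(u(1 − u))^{q−2}` on `(0, 1)` for `1 ≤ q ≤ 2` (concavity of
`x ↦ x^{2−q}`: `u^{2−q} + (1 − u)^{2−q} ≤ 2·(1/2)^{2−q}`, divided by `(u(1 − u))^{2−q}`). [ours] -/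
theorem sum_rpow_sub_two_le {q u : ℝ} (hq1 : 1 ≤ q) (hq2 : q ≤ 2) (hu0 : 0 < u) (hu1 : u < 1) :
    u ^ (q - 2) + (1 - u) ^ (q - 2) ≤ 2 * 2 ^ (q - 2) * (u * (1 - u)) ^ (q - 2) := by
  have hv0 : 0 < 1 - u := by linarith
  have hc := (Real.concaveOn_rpow (by linarith : (0 : ℝ) ≤ 2 - q) (by linarith : 2 - q ≤ 1)).2
    (mem_Ici.mpr hu0.le) (mem_Ici.mpr hv0.le) (by norm_num : (0 : ℝ) ≤ 1 / 2) (by norm_num : (0 : ℝ) ≤ 1 / 2)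
    (by norm_num)
  simp only [smul_eq_mul] at hc
  rw [show (1 : ℝ) / 2 * u + 1 / 2 * (1 - u) = 1 / 2 by ring] at hc
  -- hc : 1/2 * u^(2-q) + 1/2 * (1-u)^(2-q) ≤ (1/2)^(2-q)
  set a := u ^ (q - 2) with ha
  set b := (1 - u) ^ (q - 2) with hb
  have ha0 : 0 < a := Real.rpow_pos_of_pos hu0 _
  have hb0 : 0 < b := Real.rpow_pos_of_pos hv0 _
  have hia : u ^ (2 - q) * a = 1 := by
    rw [ha, ← Real.rpow_add hu0, show 2 - q + (q - 2) = 0 by ring, Real.rpow_zero]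
  have hib : (1 - u) ^ (2 - q) * b = 1 := by
    rw [hb, ← Real.rpow_add hv0, show 2 - q + (q - 2) = 0 by ring, Real.rpow_zero]
  have htwo : (1 / 2 : ℝ) ^ (2 - q) = 2 ^ (q - 2) := by
    rw [one_div, Real.inv_rpow (by norm_num : (0 : ℝ) ≤ 2), ← Real.rpow_neg (by norm_num : (0 : ℝ) ≤ 2)]
    congr 1; ring
  rw [htwo] at hc
  have hab : (u * (1 - u)) ^ (q - 2) = a * b := Real.mul_rpow hu0.le hv0.le
  rw [hab]
  -- a + b = (u^(2-q) a) b + ((1-u)^(2-q) b) a = (u^(2-q) + (1-u)^(2-q)) (a b)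
  have hsum : a + b = (u ^ (2 - q) + (1 - u) ^ (2 - q)) * (a * b) := by
    have e : (u ^ (2 - q) + (1 - u) ^ (2 - q)) * (a * b) =
        (u ^ (2 - q) * a) * b + ((1 - u) ^ (2 - q) * b) * a := by ring
    rw [e, hia, hib]; ring
  rw [hsum]
  have hab0 : 0 < a * b := mul_pos ha0 hb0
  nlinarith [mul_le_mul_of_nonneg_right hc hab0.le]

/-- **W2.** `u^q + (1 − u)^q ≤ 2^{1−q/2}·s^{q/2}` on `[0, 1]` for `1 ≤ q ≤ 2` (power means `M_q ≤ M_2`: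
`((u^q + v^q)/2)^{2/q} ≤ (u² + v²)/2`, and `(u² + v²)/2 ≤ s/2 = 3u² − 3u + 1`). [ours] -/
theorem sum_rpow_le_lineNsq {q u : ℝ} (hq1 : 1 ≤ q) (hq2 : q ≤ 2) (hu0 : 0 ≤ u) (hu1 : u ≤ 1) :
    u ^ q + (1 - u) ^ q ≤ 2 ^ (1 - q / 2) * lineNsq u ^ (q / 2) := by
  have hv0 : 0 ≤ 1 - u := by linarith
  have hq0 : 0 < q := by linarith
  have hqne : q ≠ 0 := hq0.ne'
  have hp : 1 ≤ 2 / q := by rw [le_div_iff₀ hq0]; linarith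
  have hJ := (convexOn_rpow hp).2 (mem_Ici.mpr (Real.rpow_nonneg hu0 q))
    (mem_Ici.mpr (Real.rpow_nonneg hv0 q)) (by norm_num : (0 : ℝ) ≤ 1 / 2) (by norm_num : (0 : ℝ) ≤ 1 / 2)
    (by norm_num)
  simp only [smul_eq_mul] at hJ
  have e1 : (u ^ q) ^ (2 / q) = u ^ 2 := by
    rw [← Real.rpow_mul hu0, show q * (2 / q) = ((2 : ℕ) : ℝ) by push_cast; field_simp, Real.rpow_natCast]
  have e2 : ((1 - u) ^ q) ^ (2 / q) = (1 - u) ^ 2 := by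
    rw [← Real.rpow_mul hv0, show q * (2 / q) = ((2 : ℕ) : ℝ) by push_cast; field_simp, Real.rpow_natCast]
  rw [e1, e2] at hJ
  -- hJ : (1/2 * u^q + 1/2 * (1-u)^q)^(2/q) ≤ 1/2 * u^2 + 1/2 * (1-u)^2
  set m : ℝ := 1 / 2 * u ^ q + 1 / 2 * (1 - u) ^ q with hm
  have hm0 : 0 ≤ m := by positivity
  have hs : 1 / 2 * u ^ 2 + 1 / 2 * (1 - u) ^ 2 ≤ lineNsq u / 2 := by
    unfold lineNsq; nlinarith [sq_nonneg (u - 1 / 2)]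
  have h1 : m ^ (2 / q) ≤ lineNsq u / 2 := hJ.trans hs
  -- raise to the power q/2
  have h2 := Real.rpow_le_rpow (Real.rpow_nonneg hm0 _) h1 (by linarith : 0 ≤ q / 2)
  rw [← Real.rpow_mul hm0, show 2 / q * (q / 2) = 1 by field_simp, Real.rpow_one,
    Real.div_rpow (lineNsq_pos u).le (by norm_num : (0 : ℝ) ≤ 2)] at h2
  -- h2 : m ≤ s^(q/2) / 2^(q/2)
  have h2pos : 0 < (2 : ℝ) ^ (q / 2) := Real.rpow_pos_of_pos two_pos _
  have e3 : (2 : ℝ) ^ (1 - q / 2) = 2 / 2 ^ (q / 2) := by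
    rw [Real.rpow_sub two_pos, Real.rpow_one]
  rw [e3]
  have h3 : m * 2 ≤ 2 / 2 ^ (q / 2) * lineNsq u ^ (q / 2) := by
    have e : 2 / 2 ^ (q / 2) * lineNsq u ^ (q / 2) = 2 * (lineNsq u ^ (q / 2) / 2 ^ (q / 2)) := by ring
    rw [e]; linarith [h2]
  have hm2 : m * 2 = u ^ q + (1 - u) ^ q := by rw [hm]; ring
  linarith

/-- **W3.** `2^{2−q}·s^{q−2} ≤ (u(1 − u))^{q−2}` on `(0, 1)` for `q ≤ 2` (`u(1 − u) ≤ s/2`, i.e.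
`(2u − 1)² ≥ 0`, and `x ↦ x^{q−2}` is antitone). [ours] -/
theorem two_rpow_mul_lineNsq_rpow_le {q u : ℝ} (hq2 : q ≤ 2) (hu0 : 0 < u) (hu1 : u < 1) :
    2 ^ (2 - q) * lineNsq u ^ (q - 2) ≤ (u * (1 - u)) ^ (q - 2) := by
  have hv0 : 0 < 1 - u := by linarith
  have h := Real.rpow_le_rpow_of_nonpos (mul_pos hu0 hv0)
    (by unfold lineNsq; nlinarith [sq_nonneg (2 * u - 1)] : u * (1 - u) ≤ lineNsq u / 2) (by linarith : q - 2 ≤ 0)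
  rw [Real.div_rpow (lineNsq_pos u).le (by norm_num : (0 : ℝ) ≤ 2)] at h
  have e : (2 : ℝ) ^ (2 - q) = 1 / 2 ^ (q - 2) := by
    rw [one_div, ← Real.rpow_neg (by norm_num : (0 : ℝ) ≤ 2)]; congr 1; ring
  rw [e]
  calc 1 / 2 ^ (q - 2) * lineNsq u ^ (q - 2) = lineNsq u ^ (q - 2) / 2 ^ (q - 2) := by ring
    _ ≤ (u * (1 - u)) ^ (q - 2) := h

/-- **(W) at the planar share for `1 < q ≤ 7/4`:** `0 ≤ T(u)` for every `u ∈ (0, 1)` at `c = c_pl(q)`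
(W1–W3 in the closed form: `T/q² ≥ ((q − 1)(7 − 4q)/3)·[(u(1 − u))^{q−2} − 2^{2−q}s^{q−2}] ≥ 0`). With
(N⁺) `lineN_cPlanar_pos` and (D) `lineD_cPlanar` this discharges ALL THREE hypotheses of K19's one-dimensional
criterion `topBotEigSplitting_of_line` at `c = c_pl(q)`, `1 < q ≤ 7/4`. Search for candidate a priori
estimates; no regularity claim. [ours] -/
theorem lineT_cPlanar_nonneg {q : ℝ} (hq : 1 < q) (hq2 : q ≤ 7 / 4) {u : ℝ} (hu0 : 0 < u) (hu1 : u < 1) :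
    0 ≤ lineT q (cPlanar q) u := by
  have hv0 : 0 < 1 - u := by linarith
  have hs0 := lineNsq_pos u
  have hq2' : q ≤ 2 := by linarith
  rw [lineT_closed_form q (cPlanar q) hu0 hu1]
  set c := cPlanar q with hc
  set P := (u * (1 - u)) ^ (q - 2) with hP
  set S2 := lineNsq u ^ (q - 2) with hS2
  set A := (2 : ℝ) ^ (1 - q / 2) with hA
  have hA0 : 0 < A := Real.rpow_pos_of_pos two_pos _
  have hP0 : 0 < P := Real.rpow_pos_of_pos (mul_pos hu0 hv0) _
  have hS20 : 0 < S2 := Real.rpow_pos_of_pos hs0 _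
  have hc' : c = (q - 1) / 3 * A := by rw [hc, cPlanar]
  have hc0 : 0 < c := by rw [hc']; exact mul_pos (by linarith) hA0 |>.trans_le' le_rfl
  -- `A² = 2^{2-q}` and `2^{q-2} = (A²)⁻¹`
  have hA2 : A ^ 2 = (2 : ℝ) ^ (2 - q) := by
    rw [hA, ← Real.rpow_mul_natCast (by norm_num : (0 : ℝ) ≤ 2)]; congr 1; push_cast; ring
  have hAinv : (2 : ℝ) ^ (q - 2) = (A ^ 2)⁻¹ := by
    rw [hA2, ← Real.rpow_neg (by norm_num : (0 : ℝ) ≤ 2)]; congr 1; ring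
  -- W1b: `s^{q/2-1} ≤ A`
  have hW1b : lineNsq u ^ (q / 2 - 1) ≤ A := by
    have h := Real.rpow_le_rpow_of_nonpos (by norm_num : (0 : ℝ) < 1 / 2)
      (by unfold lineNsq; nlinarith [sq_nonneg (u - 1 / 2)] : 1 / 2 ≤ lineNsq u) (by linarith : q / 2 - 1 ≤ 0)
    rwa [half_rpow_half_sub_one] at h
  -- term4 ≤ (4(q-1)²/3) P
  have h4 : 2 * c * (q - 1) * (u ^ (q - 2) + (1 - u) ^ (q - 2)) * lineNsq u ^ (q / 2 - 1) ≤
      4 * (q - 1) ^ 2 / 3 * P := by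
    have hW1 := sum_rpow_sub_two_le hq.le hq2' hu0 hu1
    rw [← hP, hAinv] at hW1
    have hcoef : 0 ≤ 2 * c * (q - 1) := by positivity
    calc 2 * c * (q - 1) * (u ^ (q - 2) + (1 - u) ^ (q - 2)) * lineNsq u ^ (q / 2 - 1)
        ≤ 2 * c * (q - 1) * (2 * (A ^ 2)⁻¹ * P) * A := by
          apply mul_le_mul (mul_le_mul_of_nonneg_left hW1 hcoef) hW1b (Real.rpow_nonneg hs0.le _)
          positivity
      _ = 4 * (q - 1) ^ 2 / 3 * P := by rw [hc']; field_simp; ring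
  -- term3 ≤ (q-1)(2-q) A² S2
  have h3 : 3 * c * (2 - q) * (u ^ q + (1 - u) ^ q) * lineNsq u ^ (q / 2 - 2) ≤
      (q - 1) * (2 - q) * A ^ 2 * S2 := by
    have hW2 := sum_rpow_le_lineNsq hq.le hq2' hu0.le hu1.le
    rw [← hA] at hW2
    have hcoef : 0 ≤ 3 * c * (2 - q) := by
      have : 0 ≤ 2 - q := by linarith
      positivity
    have hss : lineNsq u ^ (q / 2) * lineNsq u ^ (q / 2 - 2) = S2 := by
      rw [hS2, ← Real.rpow_add hs0]; congr 1; ring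
    calc 3 * c * (2 - q) * (u ^ q + (1 - u) ^ q) * lineNsq u ^ (q / 2 - 2)
        ≤ 3 * c * (2 - q) * (A * lineNsq u ^ (q / 2)) * lineNsq u ^ (q / 2 - 2) :=
          mul_le_mul_of_nonneg_right (mul_le_mul_of_nonneg_left hW2 hcoef) (Real.rpow_nonneg hs0.le _)
      _ = (q - 1) * (2 - q) * A ^ 2 * S2 := by rw [← hss, hc']; ring
  -- term2 = ((q-1)²/3) A² S2
  have h2 : 3 * c ^ 2 * S2 = (q - 1) ^ 2 / 3 * (A ^ 2 * S2) := by rw [hc']; ring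
  -- W3: A² S2 ≤ P
  have h5 : A ^ 2 * S2 ≤ P := by
    rw [hA2, hS2, hP]; exact two_rpow_mul_lineNsq_rpow_le hq2' hu0 hu1
  have hk : 0 ≤ (q - 1) * (7 - 4 * q) / 3 := by
    have : 0 ≤ 7 - 4 * q := by linarith
    positivity
  have hkey : 0 ≤ (q - 1) * (7 - 4 * q) / 3 * (P - A ^ 2 * S2) := mul_nonneg hk (by linarith)
  have hbr : 0 ≤ (q - 1) * P + 3 * c ^ 2 * S2
      - 3 * c * (2 - q) * (u ^ q + (1 - u) ^ q) * lineNsq u ^ (q / 2 - 2)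
      - 2 * c * (q - 1) * (u ^ (q - 2) + (1 - u) ^ (q - 2)) * lineNsq u ^ (q / 2 - 1) := by
    nlinarith [h2, h3, h4, h5, hkey]
  exact mul_nonneg (sq_nonneg q) hbr

end TopEig

end Summit.NavierStokesRegularity.FunctionalMining

end
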